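import Summits.MatrixMultiplication.MatrixMultiplication.Theorems.AbelianSTPPCensusThreeRoomEnergyKneser
import Summits.MatrixMultiplication.MatrixMultiplication.Theorems.AbelianSTPPCensusE3PlusShape

/-!
# E3K on shape data: the Kneser minimum `knLB`, the predicate `E3kAdm`, its soundness and its silence (cell mm-stpp, eng-2 g7)

Shape-level interface of the rule E3K (`STPPThreeRoomEnergy.false_of_energy3k`, this cell), in the format of the E3⁺ interface
`AbelianSTPPCensusE3PlusShape` (`e3pLHS` / `E3pAdm` / `e3pAdm_of_isSTPP`) that the cell's budgeted kernel checker consumes: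

* `knLB M n` — the **Kneser minimum** `min_{d ∣ M, d > 0} (2d⌈n/d⌉ − d)` (a fold over `List.range (M+1)`; `knLB_le`: it is below every term),
  the shape-level lower bound for `|S − S|` when `|S| = n` in an abelian group of order `M` (`two_mul_ceilDiv_le_card_sub_self`);
* `e3kLHS M x y z S_A S_B S_C` — the E3K left-hand side of ONE member for the pair `(A,B)`: the E3⁺ normal form `e3pL` with the class
  sizes `n_X = knLB M x_X − 1` (instead of `x_X − 1`) plus the pair term `(knLB M (xy) − 1 − n_A − n_B)·((V − (s_A + s_B)) − θ)`;
* `E3kAdmAB M a b c` — every member `t` with `2V_t > M` has `e3kLHS ≤ V_t²` (pair `(A,B)`); `E3kAdm` — the same for the three letter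
  rotations `(a,b,c)`, `(b,c,a)`, `(c,a,b)` (an STPP family rotates, `IsSTPP.rotate`); both evaluate by `decide` after `unfold` (no
  `Decidable` instances are declared, as for `E3pAdm`);
* `e3kAdmAB_of_isSTPP`, `e3kAdm_of_isSTPP` — **soundness**: the shape data of every `IsSTPP` family with non-empty sets in a finite
  abelian group of order `M` is `E3kAdm M`;
* `e3kAdm_of_small` — SILENT BELOW DOUBLING (vacuous when every `2V_t ≤ M`), like every rule of the E3 family;
* two evaluations by `decide`: the first E3⁺⁺-survivor `(8,6,6)+(7,7,6)²+(6,6,6)+(5,5,5)` is NOT `E3kAdm 484`, while the first recorded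
  E3K-survivor `(7,7,6)³+(6,6,6)+(5,5,5)` IS `E3kAdm 486` (so 486 is alive under this predicate, not merely unrefuted by the seat script).

* (appended, eng-2 g7) **heredity**: `e3kL_anti_A/_B/_C`, `e3kL_anti` (the left-hand side is antitone in each slack when
  `1 + n_B + n_C ≤ M`, `1 + n_A + n_C ≤ M`, `max(q, 1 + n_A + n_B) ≤ M` — three regimes as in `e3pL_anti`), `e3kLHS_mono` (monotone in the
  off-member sums when `x, y, z ≥ 1`, `xyz ≤ M` and the Kneser letter classes are small: `knLB M x + knLB M y ≤ M + 1` for the three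
  letter pairs — automatic for census shapes, a one-line `decide` per shape), and `E3kAdmAB.restrict` / `E3kAdm.restrict`: sub-lists of
  admissible lists are admissible, i.e. a PREFIX killed by E3K kills every completion — the lemma a prefix-pruning certificate needs
  (a LEAF filter needs only the soundness theorem).
WHAT THIS IS NOT: no new rule beyond p549076's, no census number, no `ω` statement, no existence claim.
-/

-- single-conjunct summit: the mandated namespace repeats `MatrixMultiplication`.
set_option linter.dupNamespace false
set_option autoImplicit false

namespace Summit.MatrixMultiplication.MatrixMultiplication.Theorems

namespace STPPThreeRoomEnergy

open Finset Literature.Computability.AlgebraicComplexity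

/-! ## The Kneser minimum over the divisors of `M` -/

/-- `knLB M n = min (2n − 1, min_{0 < d ≤ M, d ∣ M} (2·d·⌈n/d⌉ − d))` — the least value Kneser's theorem allows for `|S − S|` when
`|S| = n` inside an abelian group of order `M` (the term `d = 1` is `2n − 1`).  Computed by a right fold, so that `decide` evaluates it.
[original] -/
def knLB (M n : ℕ) : ℕ :=
  ((List.range (M + 1)).filter (fun d => decide (0 < d ∧ d ∣ M))).foldr
    (fun d acc => min (2 * (d * ((n + d - 1) / d)) - d) acc) (2 * n - 1)

/-- A right fold of `min` is below each folded term. [bookkeeping] -/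
theorem foldr_min_le (f : ℕ → ℕ) : ∀ (l : List ℕ) (init : ℕ) {d : ℕ}, d ∈ l →
    l.foldr (fun d acc => min (f d) acc) init ≤ f d
  | [], _, _, hd => absurd hd List.not_mem_nil
  | x :: l, init, d, hd => by
    rw [List.foldr_cons]
    rcases List.mem_cons.1 hd with rfl | hd
    · exact min_le_left _ _
    · exact (min_le_right _ _).trans (foldr_min_le f l init hd)

/-- `knLB M n ≤ 2·d·⌈n/d⌉ − d` for every positive divisor `d` of a positive `M`. [bookkeeping] -/
theorem knLB_le {M n d : ℕ} (hM : 0 < M) (hd : 0 < d) (hdM : d ∣ M) :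
    knLB M n ≤ 2 * (d * ((n + d - 1) / d)) - d := by
  unfold knLB
  refine foldr_min_le (fun d => 2 * (d * ((n + d - 1) / d)) - d) _ _ ?_
  rw [List.mem_filter, List.mem_range]
  exact ⟨Nat.lt_succ_of_le (Nat.le_of_dvd hM hdM), by simp [hd, hdM]⟩

/-- `knLB M n ≤ 2n − 1` (the initial value of the fold = the term `d = 1`). [bookkeeping] -/
theorem knLB_le_init (M n : ℕ) : knLB M n ≤ 2 * n - 1 := by
  unfold knLB
  generalize ((List.range (M + 1)).filter (fun d => decide (0 < d ∧ d ∣ M))) = l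
  induction l with
  | nil => simp
  | cons x l ih => rw [List.foldr_cons]; exact (min_le_right _ _).trans ih

/-! ## The E3K left-hand side of one member and the predicate -/

/-- The E3K left-hand side in SLACK variables with explicit class sizes: `M·θ + (V − θ) + n_A((V − s_A) − θ) + n_B((V − s_B) − θ) +
n_C((V − s_C) − θ) + (q − 1 − n_A − n_B)((V − (s_A + s_B)) − θ)`, `θ = V − (s_A + s_B + s_C)` (all truncated); checker-internal normal form.
[original] -/
def e3kL (M V nA nB nC q sA sB sC : ℕ) : ℕ :=
  M * (V - (sA + sB + sC)) + (V - (V - (sA + sB + sC))) +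
    nA * ((V - sA) - (V - (sA + sB + sC))) +
    nB * ((V - sB) - (V - (sA + sB + sC))) +
    nC * ((V - sC) - (V - (sA + sB + sC))) +
    (q - 1 - nA - nB) * ((V - (sA + sB)) - (V - (sA + sB + sC)))

/-- **The E3K left-hand side of one member on shape data** (pair `(A,B)`): sizes `(x, y, z)`, `V = xyz`, order `M`, off-member sums
`S_A, S_B, S_C`; class sizes `knLB M x − 1`, `knLB M y − 1`, `knLB M z − 1` and pair-class size `knLB M (xy)`; slacks `s_X = M − (V + S_X)`.
[original] -/
def e3kLHS (M x y z SA SB SC : ℕ) : ℕ :=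
  e3kL M (x * y * z) (knLB M x - 1) (knLB M y - 1) (knLB M z - 1) (knLB M (x * y))
    (M - (x * y * z + SA)) (M - (x * y * z + SB)) (M - (x * y * z + SC))

/-- **E3K on a shape list, pair `(A,B)`**: every member `t` with `2V_t > M` has `e3kLHS ≤ V_t²` with the off-member sums
`S_A = Σ_{u≠t} b_u c_u`, `S_B = Σ_{u≠t} c_u a_u`, `S_C = Σ_{u≠t} a_u b_u`.  Sound for STPP families by `e3kAdmAB_of_isSTPP`. [original] -/
def E3kAdmAB {N : ℕ} (M : ℕ) (a b c : Fin N → ℕ) : Prop :=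
  ∀ t : Fin N, M < 2 * (a t * b t * c t) →
    e3kLHS M (a t) (b t) (c t) (∑ u ∈ univ.erase t, b u * c u) (∑ u ∈ univ.erase t, c u * a u)
      (∑ u ∈ univ.erase t, a u * b u) ≤ (a t * b t * c t) ^ 2

/-- **E3K on a shape list** (all three pair classes): `E3kAdmAB` for the data `(a,b,c)` and for its letter rotations `(b,c,a)`, `(c,a,b)`.
Sound for STPP families by `e3kAdm_of_isSTPP`; no claim by itself. [original] -/
def E3kAdm {N : ℕ} (M : ℕ) (a b c : Fin N → ℕ) : Prop :=
  E3kAdmAB M a b c ∧ E3kAdmAB M b c a ∧ E3kAdmAB M c a b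

/-! ## Soundness -/

/-- The Kneser minimum is an admissible class size for `false_of_energy3k`: `(knLB M n − 1) + 1 + d ≤ 2d⌈n/d⌉` for every divisor `d`
of a positive `M`, as soon as `n ≥ 1`. [bookkeeping] -/
theorem knLB_pred_succ_add_le {M n d : ℕ} (hM : 0 < M) (hn : 0 < n) (hd : d ∈ M.divisors) :
    (knLB M n - 1) + 1 + d ≤ 2 * (d * ((n + d - 1) / d)) := by
  obtain ⟨hdM, -⟩ := Nat.mem_divisors.1 hd
  have hdpos : 0 < d := Nat.pos_of_dvd_of_pos hdM hM
  have h1 := knLB_le (n := n) hM hdpos hdM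
  have h2 : 1 ≤ (n + d - 1) / d := by
    rw [Nat.le_div_iff_mul_le hdpos]; omega
  have h3 : d ≤ d * ((n + d - 1) / d) := Nat.le_mul_of_pos_right d h2
  omega

/-- The Kneser minimum is an admissible pair-class size: `knLB M n + d ≤ 2d⌈n/d⌉` (`n ≥ 1`, `d ∣ M > 0`). [bookkeeping] -/
theorem knLB_add_le {M n d : ℕ} (hM : 0 < M) (hn : 0 < n) (hd : d ∈ M.divisors) :
    knLB M n + d ≤ 2 * (d * ((n + d - 1) / d)) := by
  have := knLB_pred_succ_add_le hM hn hd
  omega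

/-- **E3K (pair `(A,B)`) holds on the shape data of every STPP family** (finite abelian host, all sets non-empty): member by member this is
`false_of_energy3k` with the Kneser minima `knLB` as class sizes. [original] -/
theorem e3kAdmAB_of_isSTPP {H : Type*} [AddCommGroup H] [Fintype H] [DecidableEq H] {N : ℕ} {A B C : Fin N → Finset H}
    (hS : IsSTPP A B C) (hne : ∀ i, (A i).Nonempty ∧ (B i).Nonempty ∧ (C i).Nonempty) :
    E3kAdmAB (Fintype.card H) (fun i => (A i).card) (fun i => (B i).card) (fun i => (C i).card) := by
  intro t h2
  by_contra hlt
  have hpos : ∀ r, 0 < (A r).card ∧ 0 < (B r).card ∧ 0 < (C r).card :=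
    fun r => ⟨card_pos.2 (hne r).1, card_pos.2 (hne r).2.1, card_pos.2 (hne r).2.2⟩
  have hM : 0 < Fintype.card H := Fintype.card_pos
  exact false_of_energy3k hS (a := fun i => (A i).card) (b := fun i => (B i).card) (c := fun i => (C i).card)
    (fun _ => rfl) (fun _ => rfl) (fun _ => rfl) hpos rfl t _ _ _ rfl rfl rfl
    (knLB (Fintype.card H) (A t).card - 1) (knLB (Fintype.card H) (B t).card - 1)
    (knLB (Fintype.card H) (C t).card - 1) (knLB (Fintype.card H) ((A t).card * (B t).card))
    (fun d hd => knLB_pred_succ_add_le hM (hpos t).1 hd) (fun d hd => knLB_pred_succ_add_le hM (hpos t).2.1 hd)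
    (fun d hd => knLB_pred_succ_add_le hM (hpos t).2.2 hd)
    (fun d hd => knLB_add_le hM (Nat.mul_pos (hpos t).1 (hpos t).2.1) hd) h2 (not_le.mp hlt)

/-- **E3K holds on the shape data of every STPP family** (all three pair classes, via `IsSTPP.rotate`). [original] -/
theorem e3kAdm_of_isSTPP {H : Type*} [AddCommGroup H] [Fintype H] [DecidableEq H] {N : ℕ} {A B C : Fin N → Finset H}
    (hS : IsSTPP A B C) (hne : ∀ i, (A i).Nonempty ∧ (B i).Nonempty ∧ (C i).Nonempty) :
    E3kAdm (Fintype.card H) (fun i => (A i).card) (fun i => (B i).card) (fun i => (C i).card) :=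
  ⟨e3kAdmAB_of_isSTPP hS hne,
    e3kAdmAB_of_isSTPP hS.rotate fun i => ⟨(hne i).2.1, (hne i).2.2, (hne i).1⟩,
    e3kAdmAB_of_isSTPP hS.rotate.rotate fun i => ⟨(hne i).2.2, (hne i).1, (hne i).2.1⟩⟩

/-- E3K is SILENT BELOW DOUBLING: a list all of whose members have `2V_t ≤ M` is `E3kAdm M` vacuously. [bookkeeping] -/
theorem e3kAdm_of_small {N M : ℕ} {a b c : Fin N → ℕ} (h : ∀ t, 2 * (a t * b t * c t) ≤ M) : E3kAdm M a b c := by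
  refine ⟨fun t ht => absurd ht (not_lt.2 (h t)), fun t ht => absurd ht (not_lt.2 ?_), fun t ht => absurd ht (not_lt.2 ?_)⟩
  · have := h t
    calc 2 * (b t * c t * a t) = 2 * (a t * b t * c t) := by ring
      _ ≤ M := this
  · have := h t
    calc 2 * (c t * a t * b t) = 2 * (a t * b t * c t) := by ring
      _ ≤ M := this

/-! ## Two evaluations -/

/-- The first E3⁺⁺-survivor of the record, `(8,6,6)+(7,7,6)²+(6,6,6)+(5,5,5)` at 484, is NOT E3K-admissible (cf. the set-level instance
`no_866_776_776_666_555_at_484`). [original] -/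
theorem not_e3kAdm_866_776_776_666_555_484 : ¬ E3kAdm 484 ![8, 7, 7, 6, 5] ![6, 7, 7, 6, 5] ![6, 6, 6, 6, 5] := by
  unfold E3kAdm E3kAdmAB
  decide +kernel

/-- The first recorded E3K-survivor, `(7,7,6)³+(6,6,6)+(5,5,5)` at 486, IS E3K-admissible: the predicate does not see past 486 on the
recorded lists (seat table: heavy-member margin `1 517`). [original] -/
theorem e3kAdm_776x3_666_555_486 : E3kAdm 486 ![7, 7, 7, 6, 5] ![7, 7, 7, 6, 5] ![6, 6, 6, 6, 5] := by
  unfold E3kAdm E3kAdmAB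
  decide +kernel

/-! ## Monotonicity of `e3kL` in the slacks (heredity of the E3K kill) — appended eng-2 g7 -/

/-- Exact regime: if `sA + sB + sC ≤ V` then
`e3kL = M(V − σ) + σ + nA(sB+sC) + nB(sA+sC) + nC(sA+sB) + (q − 1 − nA − nB)·sC`. [bookkeeping] -/
theorem e3kL_eq_of_le {M V nA nB nC q sA sB sC : ℕ} (h : sA + sB + sC ≤ V) :
    e3kL M V nA nB nC q sA sB sC =
      M * (V - (sA + sB + sC)) + (sA + sB + sC) + nA * (sB + sC) + nB * (sA + sC) + nC * (sA + sB) +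
        (q - 1 - nA - nB) * sC := by
  unfold e3kL
  have h1 : V - (V - (sA + sB + sC)) = sA + sB + sC := by omega
  have h2 : (V - sA) - (V - (sA + sB + sC)) = sB + sC := by omega
  have h3 : (V - sB) - (V - (sA + sB + sC)) = sA + sC := by omega
  have h4 : (V - sC) - (V - (sA + sB + sC)) = sA + sB := by omega
  have h5 : (V - (sA + sB)) - (V - (sA + sB + sC)) = sC := by omega
  rw [h1, h2, h3, h4, h5]

/-- Saturated regime: if `V ≤ sA + sB + sC` then `θ = 0` and
`e3kL = V + nA(V − sA) + nB(V − sB) + nC(V − sC) + (q − 1 − nA − nB)(V − (sA + sB))`. [bookkeeping] -/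
theorem e3kL_eq_of_ge {M V nA nB nC q sA sB sC : ℕ} (h : V ≤ sA + sB + sC) :
    e3kL M V nA nB nC q sA sB sC =
      V + nA * (V - sA) + nB * (V - sB) + nC * (V - sC) + (q - 1 - nA - nB) * (V - (sA + sB)) := by
  unfold e3kL
  have h0 : V - (sA + sB + sC) = 0 := by omega
  rw [h0]
  simp

/-- `e3kL` is antitone in `sA` when `1 + nB + nC ≤ M`. [original] -/
theorem e3kL_anti_A {M V nA nB nC q sA sB sC sA' : ℕ} (hM : 1 + nB + nC ≤ M) (hA : sA ≤ sA') :
    e3kL M V nA nB nC q sA' sB sC ≤ e3kL M V nA nB nC q sA sB sC := by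
  obtain ⟨dA, rfl⟩ := Nat.exists_eq_add_of_le hA
  set P := q - 1 - nA - nB with hP
  by_cases h' : sA + dA + sB + sC ≤ V
  · have h : sA + sB + sC ≤ V := by omega
    rw [e3kL_eq_of_le h', e3kL_eq_of_le h]
    obtain ⟨θ', hθ'⟩ : ∃ θ', V - (sA + dA + sB + sC) = θ' := ⟨_, rfl⟩
    have hθ : V - (sA + sB + sC) = θ' + dA := by omega
    rw [hθ', hθ]
    have key := Nat.mul_le_mul_right dA hM
    nlinarith [key]
  · rw [e3kL_eq_of_ge (by omega : V ≤ sA + dA + sB + sC)]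
    by_cases h : sA + sB + sC ≤ V
    · rw [e3kL_eq_of_le h]
      obtain ⟨θ, hθ⟩ : ∃ θ, V - (sA + sB + sC) = θ := ⟨_, rfl⟩
      have hV : V = θ + sA + sB + sC := by omega
      rw [hθ]
      have e1 : V - (sA + dA) ≤ sB + sC := by omega
      have e2 : V - sB = θ + (sA + sC) := by omega
      have e3 : V - sC = θ + (sA + sB) := by omega
      have e4 : V - (sA + dA + sB) ≤ sC := by omega
      rw [e2, e3]
      have key := Nat.mul_le_mul_right θ hM
      have f1 := Nat.mul_le_mul_left nA e1
      have f4 := Nat.mul_le_mul_left P e4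
      nlinarith [key, f1, f4]
    · rw [e3kL_eq_of_ge (by omega : V ≤ sA + sB + sC)]
      have e1 : V - (sA + dA) ≤ V - sA := by omega
      have e4 : V - (sA + dA + sB) ≤ V - (sA + sB) := by omega
      gcongr

/-- `e3kL` is antitone in `sB` when `1 + nA + nC ≤ M`. [original] -/
theorem e3kL_anti_B {M V nA nB nC q sA sB sC sB' : ℕ} (hM : 1 + nA + nC ≤ M) (hB : sB ≤ sB') :
    e3kL M V nA nB nC q sA sB' sC ≤ e3kL M V nA nB nC q sA sB sC := by
  obtain ⟨dB, rfl⟩ := Nat.exists_eq_add_of_le hB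
  set P := q - 1 - nA - nB with hP
  by_cases h' : sA + (sB + dB) + sC ≤ V
  · have h : sA + sB + sC ≤ V := by omega
    rw [e3kL_eq_of_le h', e3kL_eq_of_le h]
    obtain ⟨θ', hθ'⟩ : ∃ θ', V - (sA + (sB + dB) + sC) = θ' := ⟨_, rfl⟩
    have hθ : V - (sA + sB + sC) = θ' + dB := by omega
    rw [hθ', hθ]
    have key := Nat.mul_le_mul_right dB hM
    nlinarith [key]
  · rw [e3kL_eq_of_ge (by omega : V ≤ sA + (sB + dB) + sC)]
    by_cases h : sA + sB + sC ≤ V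
    · rw [e3kL_eq_of_le h]
      obtain ⟨θ, hθ⟩ : ∃ θ, V - (sA + sB + sC) = θ := ⟨_, rfl⟩
      have hV : V = θ + sA + sB + sC := by omega
      rw [hθ]
      have e1 : V - (sB + dB) ≤ sA + sC := by omega
      have e2 : V - sA = θ + (sB + sC) := by omega
      have e3 : V - sC = θ + (sA + sB) := by omega
      have e4 : V - (sA + (sB + dB)) ≤ sC := by omega
      rw [e2, e3]
      have key := Nat.mul_le_mul_right θ hM
      have f1 := Nat.mul_le_mul_left nB e1
      have f4 := Nat.mul_le_mul_left P e4
      nlinarith [key, f1, f4]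
    · rw [e3kL_eq_of_ge (by omega : V ≤ sA + sB + sC)]
      have e1 : V - (sB + dB) ≤ V - sB := by omega
      have e4 : V - (sA + (sB + dB)) ≤ V - (sA + sB) := by omega
      gcongr

/-- `e3kL` is antitone in `sC` when `1 + nA + nB + (q − 1 − nA − nB) ≤ M` (i.e. `max(q, 1 + nA + nB) ≤ M`). [original] -/
theorem e3kL_anti_C {M V nA nB nC q sA sB sC sC' : ℕ} (hM : 1 + nA + nB + (q - 1 - nA - nB) ≤ M) (hC : sC ≤ sC') :
    e3kL M V nA nB nC q sA sB sC' ≤ e3kL M V nA nB nC q sA sB sC := by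
  obtain ⟨dC, rfl⟩ := Nat.exists_eq_add_of_le hC
  set P := q - 1 - nA - nB with hP
  by_cases h' : sA + sB + (sC + dC) ≤ V
  · have h : sA + sB + sC ≤ V := by omega
    rw [e3kL_eq_of_le h', e3kL_eq_of_le h]
    obtain ⟨θ', hθ'⟩ : ∃ θ', V - (sA + sB + (sC + dC)) = θ' := ⟨_, rfl⟩
    have hθ : V - (sA + sB + sC) = θ' + dC := by omega
    rw [hθ', hθ]
    have key := Nat.mul_le_mul_right dC hM
    nlinarith [key]
  · rw [e3kL_eq_of_ge (by omega : V ≤ sA + sB + (sC + dC))]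
    by_cases h : sA + sB + sC ≤ V
    · rw [e3kL_eq_of_le h]
      obtain ⟨θ, hθ⟩ : ∃ θ, V - (sA + sB + sC) = θ := ⟨_, rfl⟩
      have hV : V = θ + sA + sB + sC := by omega
      rw [hθ]
      have e1 : V - (sC + dC) ≤ sA + sB := by omega
      have e2 : V - sA = θ + (sB + sC) := by omega
      have e3 : V - sB = θ + (sA + sC) := by omega
      have e4 : V - (sA + sB) = θ + sC := by omega
      rw [e2, e3, e4]
      have key := Nat.mul_le_mul_right θ hM
      have f1 := Nat.mul_le_mul_left nC e1
      nlinarith [key, f1]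
    · rw [e3kL_eq_of_ge (by omega : V ≤ sA + sB + sC)]
      have e1 : V - (sC + dC) ≤ V - sC := by omega
      gcongr

/-- **`e3kL` is antitone in the three slacks jointly** under `1 + nB + nC ≤ M`, `1 + nA + nC ≤ M`, `max(q, 1 + nA + nB) ≤ M`. [original] -/
theorem e3kL_anti {M V nA nB nC q sA sB sC sA' sB' sC' : ℕ} (hA' : 1 + nB + nC ≤ M) (hB' : 1 + nA + nC ≤ M)
    (hC' : 1 + nA + nB + (q - 1 - nA - nB) ≤ M) (hA : sA ≤ sA') (hB : sB ≤ sB') (hC : sC ≤ sC') :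
    e3kL M V nA nB nC q sA' sB' sC' ≤ e3kL M V nA nB nC q sA sB sC :=
  (e3kL_anti_C (sA := sA') (sB := sB') hC' hC).trans
    ((e3kL_anti_B (sA := sA') (sC := sC) hB' hB).trans (e3kL_anti_A hA' hA))

/-- `knLB M n ≤ M` for `1 ≤ n ≤ M` (the term `d = M`). [bookkeeping] -/
theorem knLB_le_self {M n : ℕ} (hn : 1 ≤ n) (hnM : n ≤ M) : knLB M n ≤ M := by
  have hM : 0 < M := by omega
  have h := knLB_le (n := n) hM hM (dvd_refl M)
  have h2 : (n + M - 1) / M = 1 := Nat.div_eq_of_lt_le (by omega) (by omega)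
  rw [h2] at h
  omega

/-- A right fold of `min` is at least `m` if the initial value and every folded term are. [bookkeeping] -/
theorem le_foldr_min (f : ℕ → ℕ) (m : ℕ) : ∀ (l : List ℕ) (init : ℕ), m ≤ init → (∀ d ∈ l, m ≤ f d) →
    m ≤ l.foldr (fun d acc => min (f d) acc) init
  | [], _, hi, _ => by simpa using hi
  | x :: l, init, hi, hl => by
    rw [List.foldr_cons]
    exact le_min (hl x (by simp)) (le_foldr_min f m l init hi fun d hd => hl d (by simp [hd]))

/-- `1 ≤ knLB M n` for `n ≥ 1` (every term `2d⌈n/d⌉ − d ≥ d ≥ 1`, and the initial value is `2n − 1 ≥ 1`). [bookkeeping] -/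
theorem one_le_knLB {M n : ℕ} (hn : 1 ≤ n) : 1 ≤ knLB M n := by
  unfold knLB
  refine le_foldr_min _ 1 _ _ (by omega) fun d hd => ?_
  rw [List.mem_filter, List.mem_range] at hd
  have hd0 : 0 < d := by simpa using (of_decide_eq_true hd.2).1
  have h2 : 1 ≤ (n + d - 1) / d := by
    rw [Nat.le_div_iff_mul_le hd0]; omega
  have h3 : d ≤ d * ((n + d - 1) / d) := Nat.le_mul_of_pos_right d h2
  omega

/-- **`e3kLHS` is monotone in the off-member packing sums** when `x y z ≥ 1`, `xyz ≤ M` and the Kneser letter classes are small: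
`knLB M x + knLB M y ≤ M + 1` (three letter pairs).  Adding members raises every old member's off-member sums, so an E3K kill is
inherited by every super-family. [original] -/
theorem e3kLHS_mono {M x y z SA SB SC SA' SB' SC' : ℕ} (hx : 1 ≤ x) (hy : 1 ≤ y) (hz : 1 ≤ z) (hV : x * y * z ≤ M)
    (hxy : knLB M x + knLB M y ≤ M + 1) (hyz : knLB M y + knLB M z ≤ M + 1) (hzx : knLB M z + knLB M x ≤ M + 1)
    (hA : SA ≤ SA') (hB : SB ≤ SB') (hC : SC ≤ SC') :
    e3kLHS M x y z SA SB SC ≤ e3kLHS M x y z SA' SB' SC' := by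
  unfold e3kLHS
  have hxyM : x * y ≤ M := by
    obtain ⟨z, rfl⟩ := Nat.exists_eq_add_of_le' hz
    nlinarith [Nat.zero_le (x * y * z)]
  have hq : knLB M (x * y) ≤ M := knLB_le_self (Nat.mul_pos hx hy) hxyM
  have h1 := one_le_knLB (M := M) hx
  have h2 := one_le_knLB (M := M) hy
  have h3 := one_le_knLB (M := M) hz
  refine e3kL_anti ?_ ?_ ?_ (by omega) (by omega) (by omega)
  · omega
  · omega
  · omega

/-- **Heredity of `E3kAdmAB`.**  If a shape list with positive sizes, volumes `≤ M` and small Kneser letter classes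
(`knLB M x + knLB M y ≤ M + 1` for the three letter pairs of every member) is `E3kAdmAB M`, so is every sub-list re-indexed along an
injection `f`.  Contrapositive = the certificate form: a prefix killed by E3K at member `t` kills every completion. [original] -/
theorem E3kAdmAB.restrict {N N' M : ℕ} {a b c : Fin N → ℕ} (h : E3kAdmAB M a b c) (f : Fin N' → Fin N)
    (hf : Function.Injective f) (hpos : ∀ t, 1 ≤ a t ∧ 1 ≤ b t ∧ 1 ≤ c t) (hV : ∀ t, a t * b t * c t ≤ M)
    (hK : ∀ t, knLB M (a t) + knLB M (b t) ≤ M + 1 ∧ knLB M (b t) + knLB M (c t) ≤ M + 1 ∧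
      knLB M (c t) + knLB M (a t) ≤ M + 1) :
    E3kAdmAB M (a ∘ f) (b ∘ f) (c ∘ f) := by
  intro t h2
  simp only [Function.comp_apply] at h2 ⊢
  refine le_trans (e3kLHS_mono (hpos (f t)).1 (hpos (f t)).2.1 (hpos (f t)).2.2 (hV (f t)) (hK (f t)).1 (hK (f t)).2.1
    (hK (f t)).2.2 ?_ ?_ ?_) (h (f t) h2)
  · exact sum_erase_comp_le f hf (fun u => b u * c u) t
  · exact sum_erase_comp_le f hf (fun u => c u * a u) t
  · exact sum_erase_comp_le f hf (fun u => a u * b u) t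

/-- **Heredity of `E3kAdm`** (all three pair classes). [original] -/
theorem E3kAdm.restrict {N N' M : ℕ} {a b c : Fin N → ℕ} (h : E3kAdm M a b c) (f : Fin N' → Fin N)
    (hf : Function.Injective f) (hpos : ∀ t, 1 ≤ a t ∧ 1 ≤ b t ∧ 1 ≤ c t) (hV : ∀ t, a t * b t * c t ≤ M)
    (hK : ∀ t, knLB M (a t) + knLB M (b t) ≤ M + 1 ∧ knLB M (b t) + knLB M (c t) ≤ M + 1 ∧
      knLB M (c t) + knLB M (a t) ≤ M + 1) :
    E3kAdm M (a ∘ f) (b ∘ f) (c ∘ f) := by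
  refine ⟨h.1.restrict f hf hpos hV hK, ?_, ?_⟩
  · refine h.2.1.restrict f hf (fun t => ⟨(hpos t).2.1, (hpos t).2.2, (hpos t).1⟩) (fun t => ?_) (fun t => ?_)
    · have := hV t
      calc b t * c t * a t = a t * b t * c t := by ring
        _ ≤ M := this
    · exact ⟨(hK t).2.1, (hK t).2.2, (hK t).1⟩
  · refine h.2.2.restrict f hf (fun t => ⟨(hpos t).2.2, (hpos t).1, (hpos t).2.1⟩) (fun t => ?_) (fun t => ?_)
    · have := hV t
      calc c t * a t * b t = a t * b t * c t := by ring
        _ ≤ M := this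
    · exact ⟨(hK t).2.2, (hK t).1, (hK t).2.1⟩

end STPPThreeRoomEnergy

end Summit.MatrixMultiplication.MatrixMultiplication.Theorems
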